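import Summits.ResolutionOfSingularities.ResolutionOfSingularities.Theorems.PurelyInseparableDim4Scope
import Literature.RingTheory.MvPolynomial.IdealOfVarsBasics
import Mathlib.RingTheory.Nakayama
import Mathlib.RingTheory.Ideal.MinimalPrime.Basic
import Mathlib.RingTheory.MvPolynomial.Ideal
import Mathlib.RingTheory.Polynomial.Basic
import Mathlib.Algebra.MvPolynomial.PDeriv
import HarnessLib

/-!
# [OURS · res-dim4-pi PR-10] The ISOLATION CERTIFICATE lemma: `𝔪₀ᴺ ≤ J_q⁺(F) + 𝔪₀ᴺ⁺¹ ⇒ IsIsolated q F`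
  (Nakayama / Krull form), the monomial form of the certificate, and the `q = 2` reading `J₂⁺(F) = ⟨∂ᵢF⟩`

Cell `res-dim4-pi` (D-0157 DOOR 2), brick **PR-10** of WORD #24 (a) (`pub/res-dim4/boards/ROUTES.md`, seat
`res-dim4-p-3`), over the desk's SCOPE add-on `PurelyInseparableDim4Scope.lean` (frame v4, WORD #20; TY-8):
`PIDim4.hasseDeriv α F` (Hasse derivative `D^{(α)}`), `PIDim4.singLocusIdeal q F = J_q⁺(F) =
⟨D^{(α)}F : 0 < |α| < q⟩` (WITHOUT `F`, T-ISO-1 of idea-3 / WORD #23 (a)), `PIDim4.originIdeal K = 𝔪₀ =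
ker (eval 0)`, and `PIDim4.IsIsolated q F` («ISOLATED `q`-fold point»: `J_q⁺(F) ≤ 𝔪₀` and every minimal
prime of `J_q⁺(F)` inside `𝔪₀` is `𝔪₀`).  idea-3's isolated-regime instrument certifies
`𝔪₀ᴺ ⊆ J_q⁺(F) + 𝔪₀ᴺ⁺¹` by `𝔽_p` linear algebra (STATUS 16:00:23Z); this file is the lemma every such
certificate (F4-I / Q-ISO, EN-9's «ISOLATED» label) cites to conclude `IsIsolated`.

## What is proved

* §1 (any commutative ring `A`; ideals `J`, `𝔪`, `P`) **`le_of_pow_le_sup_pow_succ`** — the Nakayama/Krull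
  step: if `𝔪ᴺ` is finitely generated, `𝔪 ≠ ⊤` and `𝔪ᴺ ≤ J + 𝔪ᴺ⁺¹`, then EVERY prime `P` with `J ≤ P ≤ 𝔪`
  contains `𝔪` (Mathlib's Nakayama `Submodule.exists_sub_one_mem_and_smul_le_of_fg_of_le_sup` gives
  `r ∈ 1 + 𝔪` with `r·𝔪ᴺ ⊆ J ⊆ P`; `r ∉ P` as `P ≤ 𝔪 ≠ ⊤`; so `xᴺ ∈ P` for all `x ∈ 𝔪`); the weaker
  certificate `𝔪ᴺ ≤ J` (`le_of_pow_le`) needs no finiteness.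
* §2 (the frame, `K` a field, `A = K[x₁..x₄]`) `originIdeal_eq_idealOfVars` (`𝔪₀` = Mathlib's
  `MvPolynomial.idealOfVars`), `originIdeal_ne_top`, **`isIsolated_of_pow_le_sup_pow_succ`**:
  `J_q⁺(F) ≤ 𝔪₀ → 𝔪₀ᴺ ≤ J_q⁺(F) ⊔ 𝔪₀ᴺ⁺¹ → IsIsolated q F` — THE CERTIFICATE LEMMA — and
  `isIsolated_of_pow_le` (`𝔪₀ᴺ ≤ J_q⁺(F)` suffices).
* §3 **`pow_le_sup_pow_succ_of_forall_monomial`**: the certificate in the shape the instrument produces —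
  it is enough to exhibit, for every monomial `x^γ` of degree `N`, `x^γ ∈ J_q⁺(F) + 𝔪₀ᴺ⁺¹`
  (`𝔪₀ᴺ` is spanned by the degree-`N` monomials, Mathlib `MvPolynomial.pow_idealOfVars_eq_span`);
  `isIsolated_of_forall_monomial` (all in one); one row = `monomial_mem_sup_of_sub_mem` (`x^γ = G + R`,
  `G = Σ g_α D^{(α)}F ∈ J` by `sum_mul_hasseDeriv_mem_singLocusIdeal`, `R ∈ 𝔪₀ᴺ⁺¹` by the coefficient test
  `mem_originIdeal_pow_iff`), `singLocusIdeal_le_originIdeal_of_forall` (the `J ≤ 𝔪₀` clause).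
* §4 the `q = 2` reading: `hasseDeriv_single_one` (`D^{(eᵢ)} F = ∂ᵢ F`), `exists_eq_single_of_degree_eq_one`,
  **`singLocusIdeal_two`**: `J₂⁺(F) = ⟨∂₁F, ∂₂F, ∂₃F, ∂₄F⟩` (EN-9's «q = 2: the four partials»).
* §5 specimen `isIsolated_two_fermatCubic`: `F = x₁³ + x₂³ + x₃³ + x₄³`, `p = 2`: `J₂⁺ = ⟨x₁², …, x₄²⟩ ⊇ 𝔪₀⁵`,
  hence `IsIsolated 2 F` — a worked instance of the certificate with `N = 5`.

[OURS · counted 0 · elementary commutative algebra over the desk's frame; AI kernel work, weaker than expert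
review.]  Nothing here is a statement about resolution of singularities; resolution in dimension `≥ 4` /
characteristic `p > 0` is NOT proved by anything in this file.  Host item (DR-157-C):
`stmt-ResolutionOfSingularities-16155` (`MarkedTransfer.HypersurfaceOrderReduction`), helper.
-/

noncomputable section

set_option linter.dupNamespace false -- mandated namespace of this single-conjunct summit

open MvPolynomial Finset
open scoped BigOperators Pointwise

namespace Summit.ResolutionOfSingularities.ResolutionOfSingularities.Theorems.PIDim4.IsolationCert

/-! ## §1 The Nakayama / Krull step (any commutative ring) -/

/-- **Nakayama/Krull step.** Let `J, 𝔪, P` be ideals of a commutative ring with `𝔪ᴺ` finitely generated,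
`𝔪 ≠ ⊤`, and `𝔪ᴺ ≤ J + 𝔪ᴺ⁺¹`. Then every prime `P` with `J ≤ P ≤ 𝔪` contains `𝔪` (so `P = 𝔪`).
Proof: Nakayama (Stacks 00DV (3)) gives `r` with `r − 1 ∈ 𝔪` and `r·𝔪ᴺ ⊆ J ⊆ P`; `r ∉ P` (else `1 ∈ 𝔪`);
hence `xᴺ ∈ P`, so `x ∈ P`, for every `x ∈ 𝔪`. OURS (elementary).
[cite: AtiyahMacdonald1969, Prop. 2.6 / Cor. 2.7 (Nakayama's lemma)] -/
theorem le_of_pow_le_sup_pow_succ {A : Type*} [CommRing A] {J m P : Ideal A} {N : ℕ}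
    (hfg : (m ^ N).FG) (hm : m ≠ ⊤) (h : m ^ N ≤ J ⊔ m ^ (N + 1)) (hP : P.IsPrime) (hJP : J ≤ P)
    (hPm : P ≤ m) : m ≤ P := by
  have h' : m ^ N ≤ J ⊔ m • m ^ N := by
    rwa [Ideal.smul_eq_mul, ← pow_succ']
  obtain ⟨r, hr1, hr⟩ :=
    Submodule.exists_sub_one_mem_and_smul_le_of_fg_of_le_sup (N := J) hfg le_rfl h'
  have hrP : r ∉ P := by
    intro hrP
    apply hm
    rw [Ideal.eq_top_iff_one]
    have h1 : (1 : A) = r - (r - 1) := by ring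
    rw [h1]
    exact m.sub_mem (hPm hrP) hr1
  intro x hx
  have hxN : r • x ^ N ∈ J := hr (Submodule.smul_mem_pointwise_smul _ r _ (Ideal.pow_mem_pow hx N))
  rw [smul_eq_mul] at hxN
  rcases hP.mem_or_mem (hJP hxN) with h1 | h2
  · exact (hrP h1).elim
  · exact hP.mem_of_pow_mem N h2

/-- The weaker certificate `𝔪ᴺ ≤ J` (no finiteness needed): every prime `P` with `J ≤ P` contains `𝔪`.
OURS (elementary). [cite: AtiyahMacdonald1969, Prop. 1.14 / Ch. 1 (radicals and primes)] -/
theorem le_of_pow_le {A : Type*} [CommRing A] {J m P : Ideal A} {N : ℕ} (h : m ^ N ≤ J)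
    (hP : P.IsPrime) (hJP : J ≤ P) : m ≤ P :=
  fun _ hx => hP.mem_of_pow_mem N (hJP (h (Ideal.pow_mem_pow hx N)))

/-! ## §2 The certificate lemma for the frame's `IsIsolated` -/

/-- The frame's `originIdeal K = ker (eval 0)` is Mathlib's ideal of the variables `(x₁, …, x₄)`.
OURS (bookkeeping). [cite: AtiyahMacdonald1969, Ch. 1 Ex. 1.1 (the ideal (x₁,…,xₙ))] -/
theorem originIdeal_eq_idealOfVars (K : Type) [Field K] :
    originIdeal K = MvPolynomial.idealOfVars (Fin 4) K := by
  unfold originIdeal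
  rw [MvPolynomial.eval_zero, ← Literature.RingTheory.MvPolynomial.idealOfVars_eq_ker_constantCoeff]

/-- `𝔪₀ ≠ ⊤`. OURS (bookkeeping). [cite: AtiyahMacdonald1969, Ch. 1 Ex. 1.1 (the ideal (x₁,…,xₙ))] -/
theorem originIdeal_ne_top (K : Type) [Field K] : originIdeal K ≠ ⊤ := by
  rw [originIdeal_eq_idealOfVars]
  exact Literature.RingTheory.MvPolynomial.idealOfVars_ne_top

/-- **THE ISOLATION CERTIFICATE LEMMA (PR-10).** If the `q`-fold locus ideal `J_q⁺(F)` lies in `𝔪₀` (the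
origin is a `q`-fold point) and `𝔪₀ᴺ ≤ J_q⁺(F) + 𝔪₀ᴺ⁺¹` for some `N`, then the origin is an ISOLATED
`q`-fold point: every minimal prime of `J_q⁺(F)` inside `𝔪₀` is `𝔪₀` (by §1 with `A = K[x₁..x₄]`
Noetherian). This is the lemma idea-3's `𝔽_p`-linear-algebra certificates cite. OURS (elementary).
[cite: AtiyahMacdonald1969, Prop. 2.6 / Cor. 2.7 (Nakayama's lemma)] -/
theorem isIsolated_of_pow_le_sup_pow_succ {K : Type} [Field K] {q : ℕ} {F : MvPolynomial (Fin 4) K}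
    (hJ : singLocusIdeal q F ≤ originIdeal K) {N : ℕ}
    (h : originIdeal K ^ N ≤ singLocusIdeal q F ⊔ originIdeal K ^ (N + 1)) : IsIsolated q F :=
  ⟨hJ, fun _ hP hPm => le_antisymm hPm
    (le_of_pow_le_sup_pow_succ (IsNoetherian.noetherian _) (originIdeal_ne_top K) h hP.1.1 hP.1.2 hPm)⟩

/-- The sufficient special case `𝔪₀ᴺ ≤ J_q⁺(F)` (e.g. `J_q⁺(F) ∋ x₁^{a₁}, …, x₄^{a₄}`). OURS (elementary).
[cite: AtiyahMacdonald1969, Prop. 1.14 / Ch. 1 (radicals and primes)] -/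
theorem isIsolated_of_pow_le {K : Type} [Field K] {q : ℕ} {F : MvPolynomial (Fin 4) K}
    (hJ : singLocusIdeal q F ≤ originIdeal K) {N : ℕ} (h : originIdeal K ^ N ≤ singLocusIdeal q F) :
    IsIsolated q F :=
  ⟨hJ, fun _ hP hPm => le_antisymm hPm (le_of_pow_le h hP.1.1 hP.1.2)⟩

/-! ## §3 The certificate in monomial form -/

/-- **Monomial form of the certificate**: to certify `𝔪₀ᴺ ≤ J + 𝔪₀ᴺ⁺¹` it suffices to put every monomial
`x^γ` of degree exactly `N` into `J + 𝔪₀ᴺ⁺¹` (`𝔪₀ᴺ` is spanned by them). This is the shape of idea-3's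
linear-algebra certificate (one row per degree-`N` monomial). OURS (elementary).
[cite: AtiyahMacdonald1969, Ch. 1 Ex. 1.1 (the ideal (x₁,…,xₙ))] -/
theorem pow_le_sup_pow_succ_of_forall_monomial {K : Type} [Field K]
    {J : Ideal (MvPolynomial (Fin 4) K)} {N : ℕ}
    (h : ∀ γ : Fin 4 →₀ ℕ, γ.degree = N → monomial γ (1 : K) ∈ J ⊔ originIdeal K ^ (N + 1)) :
    originIdeal K ^ N ≤ J ⊔ originIdeal K ^ (N + 1) := by
  conv_lhs => rw [originIdeal_eq_idealOfVars, MvPolynomial.pow_idealOfVars_eq_span]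
  rw [Ideal.span_le]
  rintro _ ⟨γ, hγ, rfl⟩
  exact h γ hγ

/-- **Certificate ⇒ ISOLATED, all in one**: `J_q⁺(F) ≤ 𝔪₀` and every degree-`N` monomial in
`J_q⁺(F) + 𝔪₀ᴺ⁺¹` give `IsIsolated q F`. OURS (elementary).
[cite: AtiyahMacdonald1969, Prop. 2.6 / Cor. 2.7 (Nakayama's lemma)] -/
theorem isIsolated_of_forall_monomial {K : Type} [Field K] {q : ℕ} {F : MvPolynomial (Fin 4) K}
    (hJ : singLocusIdeal q F ≤ originIdeal K) {N : ℕ}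
    (h : ∀ γ : Fin 4 →₀ ℕ, γ.degree = N →
      monomial γ (1 : K) ∈ singLocusIdeal q F ⊔ originIdeal K ^ (N + 1)) : IsIsolated q F :=
  isIsolated_of_pow_le_sup_pow_succ hJ (pow_le_sup_pow_succ_of_forall_monomial h)

/-- **One certificate row.** `x^γ ∈ J + 𝔪₀ᴺ⁺¹` from an explicit `G ∈ J` with `x^γ − G ∈ 𝔪₀ᴺ⁺¹`
(the remainder is checked on coefficients by `mem_originIdeal_pow_iff`). OURS (bookkeeping).
[cite: AtiyahMacdonald1969, Ch. 1 Ex. 1.1 (the ideal (x₁,…,xₙ))] -/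
theorem monomial_mem_sup_of_sub_mem {K : Type} [Field K] {J : Ideal (MvPolynomial (Fin 4) K)} {N : ℕ}
    {γ : Fin 4 →₀ ℕ} {G : MvPolynomial (Fin 4) K} (hG : G ∈ J)
    (hR : monomial γ (1 : K) - G ∈ originIdeal K ^ (N + 1)) :
    monomial γ (1 : K) ∈ J ⊔ originIdeal K ^ (N + 1) := by
  have : monomial γ (1 : K) = G + (monomial γ 1 - G) := by ring
  rw [this]
  exact Submodule.add_mem_sup hG hR

/-- **Explicit members of `J_q⁺(F)`**: any combination `Σ_{α ∈ T} g_α · D^{(α)}F` with `0 < |α| < q` on `T`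
lies in `singLocusIdeal q F` (the `G` of a certificate row). OURS (bookkeeping).
[cite: Giraud1975, §1 (Hasse–Schmidt derivations)] -/
theorem sum_mul_hasseDeriv_mem_singLocusIdeal {K : Type} [Field K] {q : ℕ} (F : MvPolynomial (Fin 4) K)
    (T : Finset (Fin 4 →₀ ℕ)) (hT : ∀ α ∈ T, 0 < α.degree ∧ α.degree < q)
    (g : (Fin 4 →₀ ℕ) → MvPolynomial (Fin 4) K) :
    ∑ α ∈ T, g α * hasseDeriv α F ∈ singLocusIdeal q F := by
  refine Ideal.sum_mem _ fun α hα => Ideal.mul_mem_left _ _ (Ideal.subset_span ?_)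
  exact ⟨α, (hT α hα).1, (hT α hα).2, rfl⟩

/-- Membership in `𝔪₀ⁿ` read on coefficients (all monomials of degree `< n` vanish) — the test the
instrument uses for the remainder term. OURS (bookkeeping; Mathlib `mem_pow_idealOfVars_iff'`).
[cite: AtiyahMacdonald1969, Ch. 1 Ex. 1.1 (the ideal (x₁,…,xₙ))] -/
theorem mem_originIdeal_pow_iff {K : Type} [Field K] (n : ℕ) (G : MvPolynomial (Fin 4) K) :
    G ∈ originIdeal K ^ n ↔ ∀ d : Fin 4 →₀ ℕ, d.degree < n → coeff d G = 0 := by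
  rw [originIdeal_eq_idealOfVars, MvPolynomial.mem_pow_idealOfVars_iff']

/-- In particular `J ≤ 𝔪₀` iff every generator has vanishing constant term; for `J_q⁺(F)`: every
`D^{(α)}F(0) = 0`, `0 < |α| < q`, i.e. `F` has no monomial of degree strictly between `0` and `q`
(sufficient form). OURS (bookkeeping). [cite: Giraud1975, §1 (Hasse–Schmidt derivations)] -/
theorem singLocusIdeal_le_originIdeal_of_forall {K : Type} [Field K] {q : ℕ} {F : MvPolynomial (Fin 4) K}
    (h : ∀ α : Fin 4 →₀ ℕ, 0 < α.degree → α.degree < q → constantCoeff (hasseDeriv α F) = 0) :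
    singLocusIdeal q F ≤ originIdeal K := by
  unfold singLocusIdeal
  rw [Ideal.span_le]
  rintro _ ⟨α, h0, hq, rfl⟩
  rw [SetLike.mem_coe, originIdeal_eq_idealOfVars,
    Literature.RingTheory.MvPolynomial.mem_idealOfVars_iff_constantCoeff_eq_zero]
  exact h α h0 hq

/-! ## §4 The `q = 2` reading: `J₂⁺(F) = ⟨∂₁F, …, ∂₄F⟩` -/

/-- An exponent of degree `1` is a unit vector. OURS (bookkeeping; Mathlib `Finsupp.sum_eq_one_iff`). -/
theorem exists_eq_single_of_degree_eq_one {γ : Fin 4 →₀ ℕ} (h : γ.degree = 1) :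
    ∃ i, γ = Finsupp.single i 1 :=
  (Finsupp.sum_eq_one_iff γ).mp h

/-- **The first Hasse derivatives are the partial derivatives**: `D^{(eᵢ)} F = ∂ᵢ F`
(`∏ₖ C(dₖ, (eᵢ)ₖ) = dᵢ`). OURS (bookkeeping over the frame's `hasseDeriv`).
[cite: Giraud1975, §1 (Hasse–Schmidt derivations)] -/
theorem hasseDeriv_single_one {K : Type} [Field K] (i : Fin 4) (F : MvPolynomial (Fin 4) K) :
    hasseDeriv (Finsupp.single i 1) F = pderiv i F := by
  unfold hasseDeriv
  conv_rhs => rw [F.as_sum, map_sum]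
  refine Finset.sum_congr rfl fun d _ => ?_
  rw [pderiv_monomial]
  congr 1
  rw [Finset.prod_eq_single i, Finsupp.single_eq_same, Nat.choose_one_right, mul_comm]
  · intro k _ hk
    rw [Finsupp.single_eq_of_ne hk, Nat.choose_zero_right, Nat.cast_one]
  · intro hi
    exact (hi (Finset.mem_univ i)).elim

/-- **`J₂⁺(F) = ⟨∂₁F, ∂₂F, ∂₃F, ∂₄F⟩`** — the `q = 2` reading of the frame's `q`-fold locus ideal (EN-9:
«q = 2: the four partials, no F»). OURS (bookkeeping). [cite: Giraud1975, §1 (Hasse–Schmidt derivations)] -/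
theorem singLocusIdeal_two {K : Type} [Field K] (F : MvPolynomial (Fin 4) K) :
    singLocusIdeal 2 F = Ideal.span (Set.range fun i : Fin 4 => pderiv i F) := by
  unfold singLocusIdeal
  congr 1
  ext G
  constructor
  · rintro ⟨α, h0, h2, rfl⟩
    obtain ⟨i, rfl⟩ := exists_eq_single_of_degree_eq_one (γ := α) (by omega)
    exact ⟨i, (hasseDeriv_single_one i F).symm⟩
  · rintro ⟨i, rfl⟩
    exact ⟨Finsupp.single i 1, by rw [Finsupp.degree_single]; exact Nat.one_pos,
      by rw [Finsupp.degree_single]; exact Nat.lt_succ_self 1, (hasseDeriv_single_one i F).symm⟩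

/-! ## §5 Specimen: the Fermat cubic at `p = 2` is an isolated double point -/

/-- **Specimen.** Over a field of characteristic `2`, `F = x₁³ + x₂³ + x₃³ + x₄³` has
`∂ᵢF = 3xᵢ² = xᵢ²`, so `J₂⁺(F) = ⟨x₁², x₂², x₃², x₄²⟩ ⊇ 𝔪₀⁵` and `J₂⁺(F) ≤ 𝔪₀`: the origin is an ISOLATED
double point of `z² + F` (certificate with `N = 5` via `isIsolated_of_pow_le`). OURS (worked instance;
calibration value only). [cite: Giraud1975, §1 (Hasse–Schmidt derivations)] -/
theorem isIsolated_two_fermatCubic {K : Type} [Field K] [CharP K 2] :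
    IsIsolated 2 (X 0 ^ 3 + X 1 ^ 3 + X 2 ^ 3 + X 3 ^ 3 : MvPolynomial (Fin 4) K) := by
  set F : MvPolynomial (Fin 4) K := X 0 ^ 3 + X 1 ^ 3 + X 2 ^ 3 + X 3 ^ 3 with hF
  have h3 : (3 : MvPolynomial (Fin 4) K) = 1 := by
    have h2 : (2 : MvPolynomial (Fin 4) K) = 0 := by
      have := CharP.cast_eq_zero (MvPolynomial (Fin 4) K) 2
      simpa using this
    have : (3 : MvPolynomial (Fin 4) K) = 2 + 1 := by norm_num
    rw [this, h2, zero_add]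
  have hpd : ∀ i : Fin 4, pderiv i F = X i ^ 2 := by
    intro i
    simp only [hF, map_add, (pderiv i).leibniz_pow, pderiv_X, Pi.single_apply, nsmul_eq_mul,
      Nat.cast_ofNat]
    fin_cases i <;> simp [h3]
  have hJ : singLocusIdeal 2 F = Ideal.span (Set.range fun i : Fin 4 => (X i : MvPolynomial (Fin 4) K) ^ 2) := by
    rw [singLocusIdeal_two]
    simp_rw [hpd]
  refine isIsolated_of_pow_le (N := 5) ?_ ?_
  · rw [hJ, Ideal.span_le, originIdeal_eq_idealOfVars]
    rintro _ ⟨i, rfl⟩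
    exact Ideal.pow_le_self two_ne_zero
      (Literature.RingTheory.MvPolynomial.X_pow_mem_idealOfVars_pow i 2)
  · rw [hJ]
    conv_lhs => rw [originIdeal_eq_idealOfVars, MvPolynomial.pow_idealOfVars_eq_span]
    rw [Ideal.span_le]
    rintro _ ⟨γ, hγ, rfl⟩
    -- some coordinate of γ is ≥ 2 (pigeonhole: |γ| = 5 over 4 coordinates)
    have hγ5 : γ.degree = 5 := hγ
    obtain ⟨i, hi⟩ : ∃ i : Fin 4, 2 ≤ γ i := by
      by_contra hc
      push Not at hc
      have : γ.degree ≤ 4 := by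
        rw [Finsupp.degree_eq_sum]
        calc ∑ i, γ i ≤ ∑ _i : Fin 4, 1 := Finset.sum_le_sum fun i _ => Nat.lt_succ_iff.mp (hc i)
          _ = 4 := by simp
      omega
    have hγi : Finsupp.single i 2 + (γ - Finsupp.single i 2) = γ := by
      ext k
      rw [Finsupp.add_apply, Finsupp.tsub_apply, Finsupp.single_apply]
      split_ifs with hik
      · subst hik; omega
      · omega
    have hdvd : (X i : MvPolynomial (Fin 4) K) ^ 2 ∣ monomial γ 1 := by
      refine ⟨monomial (γ - Finsupp.single i 2) 1, ?_⟩
      rw [X_pow_eq_monomial, monomial_mul, one_mul, hγi]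
    exact Ideal.mem_of_dvd _ hdvd (Ideal.subset_span ⟨i, rfl⟩)

end Summit.ResolutionOfSingularities.ResolutionOfSingularities.Theorems.PIDim4.IsolationCert

end
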